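import Summits.NavierStokesRegularity.NavierStokesRegularity.Theorems.GaldiLiouvilleGateParabolicGaldiLiouvilleStubSobolevSixFrobenius
import Summits.NavierStokesRegularity.NavierStokesRegularity.Theorems.GaldiLiouvilleGateParabolicGaldiLiouvilleStubLpsSixFourOfSobolev
import Summits.NavierStokesRegularity.NavierStokesRegularity.Theorems.GaldiLiouvilleGateParabolicGaldiLiouvilleKnownCases
import Literature.Analysis.FluidPDE.AncientLPSLiouvilleProofs
import Mathlib.Analysis.SpecialFunctions.ImproperIntegrals
import Mathlib.MeasureTheory.Measure.Lebesgue.Integral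
import HarnessLib

/-!
# Crux `ParabolicGaldiLiouville` (stmt-NavierStokesRegularity-0893): X2 HOLDS for flows whose
# enstrophy decays faster than the self-similar rate (the positive content of the sharp gate)

Helper file of the line lead (theorems only; no sorry, standard axioms).

X2 = `GaldiLiouvilleGate.ParabolicGaldiLiouville` asks that every smooth bounded ancient mild
Navier–Stokes solution `v` on `ℝ³ × (−∞,0)` with uniformly bounded enstrophy
`E(s) = ∫ |∇v(s)|_F² ≤ C` and `L⁶` slices vanish. The reshaped birth line (sharp gate, lead c1)
proved `X2 ⇐ ∫_{s<0} E(s)² ds < ∞` through Seregin's Liouville theorem at the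
Ladyzhenskaya–Prodi–Serrin exponents `(6, 4)`. This file turns that into UNCONDITIONAL, quotable
rungs of the crux:

* `DecayRung.eq_zero_of_sqIntegrableEnstrophy` — a bounded ancient mild solution, smooth on
  `(−∞,0) × ℝ³`, with `L⁶` slices and `∫_{s<0} E(s)² ds < ∞` is identically zero;
* `parabolicGaldiLiouville_of_enstrophyDecay` — a flow of the X2 class whose enstrophy decays like
  `E(s) ≤ A (−s)^{−a}` for `s < T` with SOME `a > 1/2` is identically zero.

The exponent `a = 1/2` is exactly the backward self-similar / Type-I rate (`(−s)^{−1/2}` is the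
scale-invariant enstrophy profile), where `∫ E² ~ ∫ ds/(−s)` diverges logarithmically: the
dissipation gate reaches every strictly-faster-than-self-similar infrared behaviour and stops at
Type I. Ingredients: the landed stubs `stub_sobolevSixFrobenius` (2a) and
`stub_lpsSixFourOfSobolev` (2b′), the tree's `Seregin2014_ancient_liouville_LPS_holds` at
`(s, l) = (6, 4)`, the a.e.-to-everywhere upgrade for continuous slices, and the calculus fact
`∫_{−∞}^{T} (−s)^{−2a} ds < ∞` for `2a > 1`, `T < 0` (Mathlib `integrableOn_Ioi_rpow_of_lt` after
the reflection `s ↦ −s`, under which Lebesgue measure is invariant).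
-/

noncomputable section

set_option linter.dupNamespace false

namespace Summit.NavierStokesRegularity.NavierStokesRegularity.Theorems.ParabolicGaldiLiouville.Birth

open MeasureTheory Filter Topology Set Function
open scoped ENNReal NNReal
open Literature.Analysis.FluidPDE

namespace DecayRung

/-- **a.e. ⇒ everywhere for continuous slices.** If `v` is continuous on `(−∞,0) × ℝ³` and
`v(t,·) = 0` a.e. in space for a.e. `t < 0`, then `v s y = 0` for every `s < 0` and every `y`
(a continuous slice equals its a.e. class; a non-zero value would persist on a time
neighbourhood of positive measure). Same argument as the skeleton's glue. -/
theorem eq_zero_of_ae_of_continuousOn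
    {v : ℝ → EuclideanSpace ℝ (Fin 3) → EuclideanSpace ℝ (Fin 3)}
    (hc : ContinuousOn (uncurry v) (Iio 0 ×ˢ univ))
    (hae : ∀ᵐ t ∂((volume : Measure ℝ).restrict (Iio 0)),
      v t =ᵐ[(volume : Measure (EuclideanSpace ℝ (Fin 3)))] 0) :
    ∀ s < 0, ∀ y, v s y = 0 := by
  have h1 : ∀ᵐ t ∂(volume : Measure ℝ), t ∈ Iio (0 : ℝ) → v t = 0 := by
    refine (ae_restrict_iff' measurableSet_Iio).1 ?_
    filter_upwards [hae, ae_restrict_mem measurableSet_Iio] with t ht htI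
    exact (Continuous.ae_eq_iff_eq volume (KnownCases.continuous_slice hc htI) continuous_const).1 ht
  intro s hs y
  by_contra hne
  have hca : ContinuousAt (fun t => v t y) s := by
    have h' : ContinuousAt (uncurry v) (s, y) :=
      hc.continuousAt ((isOpen_Iio.prod isOpen_univ).mem_nhds ⟨hs, mem_univ _⟩)
    have hg : ContinuousAt (fun t : ℝ => (t, y)) s :=
      (continuous_id.prodMk continuous_const).continuousAt
    exact ContinuousAt.comp (g := uncurry v) (f := fun t : ℝ => (t, y)) h' hg
  have hA : {t : ℝ | v t y ≠ 0 ∧ t < 0} ∈ 𝓝 s :=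
    (hca.eventually_ne hne).and (Iio_mem_nhds hs)
  have hpos : 0 < volume {t : ℝ | v t y ≠ 0 ∧ t < 0} := Measure.measure_pos_of_mem_nhds volume hA
  have hnull : volume {t : ℝ | v t y ≠ 0 ∧ t < 0} = 0 := by
    refine measure_mono_null (fun t ht => ?_) (ae_iff.1 h1)
    simp only [mem_setOf_eq] at ht ⊢
    intro himp
    exact ht.1 (by simpa using congrFun (himp ht.2) y)
  exact hpos.ne' hnull

/-- **The sharp gate, assembled (unconditional): square-integrable enstrophy history ⇒ `v ≡ 0`.**
For a bounded ancient mild solution (`ν = 1`), smooth on `(−∞,0) × ℝ³`, with `L⁶` slices and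
`∫_{s<0} (∫|∇v(s)|_F²)² ds < ∞`: the landed stubs 2a/2b′ give the finite LPS quantity at `(6,4)`,
Seregin's theorem (tree, Thm 4.12) gives a.e. vanishing, continuity upgrades it. -/
theorem eq_zero_of_sqIntegrableEnstrophy
    {v : ℝ → EuclideanSpace ℝ (Fin 3) → EuclideanSpace ℝ (Fin 3)}
    (hv : IsBoundedAncientMildSolution 1 v)
    (hsm : ContDiffOn ℝ (⊤ : ℕ∞) (uncurry v) (Iio 0 ×ˢ univ))
    (hL6 : ∀ s < 0, MemLp (v s) 6 volume)
    (hsq : (∫⁻ s in Iio 0, (∫⁻ y, ENNReal.ofReal (frobeniusNormSq (fderiv ℝ (v s) y))) ^ 2) < ⊤) :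
    ∀ s < 0, ∀ y, v s y = 0 := by
  have hlps := stub_lpsSixFourOfSobolev stub_sobolevSixFrobenius v hsm hL6 hsq
  have hc : ContinuousOn (uncurry v) (Iio 0 ×ˢ univ) := hsm.continuousOn
  have hmeas : AEStronglyMeasurable (uncurry v)
      ((volume : Measure (ℝ × EuclideanSpace ℝ (Fin 3))).restrict (Iio 0 ×ˢ univ)) :=
    hc.aestronglyMeasurable (measurableSet_Iio.prod MeasurableSet.univ)
  have hsl : ∀ t < 0, AEStronglyMeasurable (v t) volume := fun t ht =>
    (KnownCases.continuous_slice hc ht).aestronglyMeasurable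
  have hae : ∀ᵐ t ∂((volume : Measure ℝ).restrict (Iio 0)),
      v t =ᵐ[(volume : Measure (EuclideanSpace ℝ (Fin 3)))] 0 :=
    Seregin2014_ancient_liouville_LPS_holds.of_isBoundedAncientMildSolution hv hmeas hsl
      (s := 6) (l := 4) (by norm_num) (by norm_num) hlps
  exact eq_zero_of_ae_of_continuousOn hc hae

/-- **Calculus: `∫_{s<T} (−s)^{−2a} ds < ∞` for `T < 0`, `1/2 < a`** (as an extended integral of
`ofReal`), by the reflection `s ↦ −s` (Lebesgue measure is reflection invariant) and Mathlib's
`integrableOn_Ioi_rpow_of_lt` on `(−T, ∞)`. -/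
theorem lintegral_Iio_rpow_lt_top {T a : ℝ} (hT : T < 0) (ha : 1 / 2 < a) :
    (∫⁻ s in Iio T, ENNReal.ofReal ((-s) ^ (-(2 * a)))) < ⊤ := by
  have hint : IntegrableOn (fun t : ℝ => t ^ (-(2 * a))) (Ioi (-T)) volume :=
    integrableOn_Ioi_rpow_of_lt (by linarith) (by linarith)
  have A : MeasurableEmbedding (Neg.neg : ℝ → ℝ) :=
    (Homeomorph.neg ℝ).isClosedEmbedding.measurableEmbedding
  have hpre : (Neg.neg : ℝ → ℝ) ⁻¹' Iio T = Ioi (-T) := by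
    ext x
    simp only [mem_preimage, mem_Iio, mem_Ioi]
    constructor <;> intro h <;> linarith
  have h1 : (volume : Measure ℝ).restrict (Iio T) =
      ((volume.restrict ((Neg.neg : ℝ → ℝ) ⁻¹' Iio T)).map (Neg.neg : ℝ → ℝ)) := by
    have h := A.restrict_map (volume : Measure ℝ) (Iio T)
    rw [Measure.map_neg_eq_self (volume : Measure ℝ)] at h
    exact h
  have key : (∫⁻ s in Iio T, ENNReal.ofReal ((-s) ^ (-(2 * a)))) =
      ∫⁻ t in Ioi (-T), ENNReal.ofReal (t ^ (-(2 * a))) := by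
    rw [h1, A.lintegral_map, hpre]
    simp only [neg_neg]
  rw [key]
  exact hint.setLIntegral_lt_top

/-- **Decay faster than self-similar ⇒ square-integrable enstrophy history.** If `E(s) ≤ C` for
all `s < 0` and `E(s) ≤ A (−s)^{−a}` for `s < T` (`T < 0`, `a > 1/2`), then `∫_{s<0} E(s)² ds < ∞`:
split `(−∞,0) = (−∞,T) ∪ [T,0)`; on the bounded piece `E² ≤ C²`, on the tail
`E² ≤ A² (−s)^{−2a}` which is integrable (`lintegral_Iio_rpow_lt_top`). -/
theorem sqIntegrable_of_decay {E : ℝ → ℝ≥0∞} {C : NNReal} {A a T : ℝ}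
    (hC : ∀ s < 0, E s ≤ C) (hT : T < 0) (ha : 1 / 2 < a)
    (hdec : ∀ s < T, E s ≤ ENNReal.ofReal A * ENNReal.ofReal ((-s) ^ (-a))) :
    (∫⁻ s in Iio 0, E s ^ 2) < ⊤ := by
  -- the bounded piece `[T, 0)`
  have hfin : (∫⁻ s in Ico T 0, E s ^ 2) < ⊤ := by
    calc (∫⁻ s in Ico T 0, E s ^ 2) ≤ ∫⁻ s in Ico T 0, (C : ℝ≥0∞) ^ 2 :=
          setLIntegral_mono' measurableSet_Ico fun s hs => by
            gcongr
            exact hC s hs.2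
      _ = (C : ℝ≥0∞) ^ 2 * volume (Ico T 0) := setLIntegral_const _ _
      _ < ⊤ := by
          rw [Real.volume_Ico]
          exact ENNReal.mul_lt_top (ENNReal.pow_lt_top ENNReal.coe_lt_top) ENNReal.ofReal_lt_top
  -- the tail `(−∞, T)`
  have htail : (∫⁻ s in Iio T, E s ^ 2) < ⊤ := by
    have hle : ∀ s ∈ Iio T, E s ^ 2 ≤
        ENNReal.ofReal A ^ 2 * ENNReal.ofReal ((-s) ^ (-(2 * a))) := fun s hs => by
      have hs' : 0 ≤ -s := by
        have : s < T := hs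
        linarith
      calc E s ^ 2 ≤ (ENNReal.ofReal A * ENNReal.ofReal ((-s) ^ (-a))) ^ 2 := by
            gcongr
            exact hdec s hs
        _ = ENNReal.ofReal A ^ 2 * ENNReal.ofReal ((-s) ^ (-(2 * a))) := by
            rw [mul_pow, ← ENNReal.ofReal_pow (Real.rpow_nonneg hs' _)]
            congr 2
            rw [← Real.rpow_natCast, ← Real.rpow_mul hs']
            congr 1
            push_cast
            ring
    calc (∫⁻ s in Iio T, E s ^ 2)
        ≤ ∫⁻ s in Iio T, ENNReal.ofReal A ^ 2 * ENNReal.ofReal ((-s) ^ (-(2 * a))) :=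
          setLIntegral_mono' measurableSet_Iio hle
      _ = ENNReal.ofReal A ^ 2 * ∫⁻ s in Iio T, ENNReal.ofReal ((-s) ^ (-(2 * a))) :=
          lintegral_const_mul' _ _ (ENNReal.pow_ne_top ENNReal.ofReal_ne_top)
      _ < ⊤ := ENNReal.mul_lt_top (ENNReal.pow_lt_top ENNReal.ofReal_lt_top)
          (lintegral_Iio_rpow_lt_top hT ha)
  -- assemble
  have hunion : Iio (0 : ℝ) = Iio T ∪ Ico T 0 := (Iio_union_Ico_eq_Iio hT.le).symm
  rw [hunion]
  exact (lintegral_union_le _ _ _).trans_lt (ENNReal.add_lt_top.2 ⟨htail, hfin⟩)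

end DecayRung

/-- **X2 holds for flows whose enstrophy decays faster than the self-similar rate (unconditional
rung of the crux; lead c1, sharp gate).** Let `v` be a bounded ancient mild solution of
Navier–Stokes (`ν = 1`), smooth on `(−∞,0) × ℝ³`, with uniformly bounded enstrophy
`E(s) = ∫|∇v(s)|_F² ≤ C` and `L⁶` slices (the class of X2). If for SOME `a > 1/2`, `A` and
`T < 0` one has `E(s) ≤ A (−s)^{−a}` for all `s < T`, then `v ≡ 0` on `(−∞,0) × ℝ³`. Proof:
`∫_{s<0} E² < ∞` (`DecayRung.sqIntegrable_of_decay`), then the assembled sharp gate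
(`DecayRung.eq_zero_of_sqIntegrableEnstrophy`: landed stubs 2a/2b′, Seregin 2014 Thm 4.12 at
`(6,4)`, continuity). The borderline `a = 1/2` is the backward self-similar (Type I) rate, where
`∫ E²` diverges logarithmically: this is as far as the dissipation gate reaches. -/
theorem parabolicGaldiLiouville_of_enstrophyDecay :
    ∀ v : ℝ → EuclideanSpace ℝ (Fin 3) → EuclideanSpace ℝ (Fin 3),
      Literature.Analysis.FluidPDE.IsBoundedAncientMildSolution 1 v →
      ContDiffOn ℝ (⊤ : ℕ∞) (Function.uncurry v) (Set.Iio 0 ×ˢ Set.univ) →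
      (∃ C : NNReal, ∀ s < 0, ∫⁻ y, ENNReal.ofReal
          (Literature.Analysis.FluidPDE.frobeniusNormSq (fderiv ℝ (v s) y)) ≤ C) →
      (∀ s < 0, MeasureTheory.MemLp (v s) 6 MeasureTheory.volume) →
      (∃ A a T : ℝ, 1 / 2 < a ∧ T < 0 ∧ ∀ s < T,
        (∫⁻ y, ENNReal.ofReal (Literature.Analysis.FluidPDE.frobeniusNormSq (fderiv ℝ (v s) y))) ≤
          ENNReal.ofReal A * ENNReal.ofReal ((-s) ^ (-a))) →
      ∀ s < 0, ∀ y, v s y = 0 := by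
  intro v hv hsm hens hL6 hdecay
  obtain ⟨C, hC⟩ := hens
  obtain ⟨A, a, T, ha, hT, hdec⟩ := hdecay
  have hsq := DecayRung.sqIntegrable_of_decay
    (E := fun s => ∫⁻ y, ENNReal.ofReal (frobeniusNormSq (fderiv ℝ (v s) y))) hC hT ha hdec
  exact DecayRung.eq_zero_of_sqIntegrableEnstrophy hv hsm hL6 hsq

end Summit.NavierStokesRegularity.NavierStokesRegularity.Theorems.ParabolicGaldiLiouville.Birth

end
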